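import Literature.Probability.Percolation.ZdLowestFrontierFeet
import Literature.Probability.Percolation.ZdFiveArmQuasiMultOfSeparation
import HarnessLib

/-!
# The environment of Nolin's five-arm construction: heights of the lowest crossing, the two columns

Topic `Literature/Probability/Percolation`; bond percolation on `ℤ²`. Fourth file of the bond-`ℤ²`
rendering of Nolin's construction of a five-arm vertex (P. Nolin, EJP 13 (2008), §5.2, proof of
Thm. 24 (ii) [arXiv 0711.4948: Thm. 23 (ii), p. 17]; site-`𝕋` twin: `FiveArmEvent.lean`), on top
of `ZdLowestFrontier.lean`, `ZdLowestFrontierFeet.lean`, `ZdFiveArmVertex.lean`.  Nolin: "By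
standard RSW-type arguments with probability at least 1/2 there's a LR black crossing in the strip
`[-N, N] × [-N/2, N/2]` (rather than the whole `S_N`) ... Assume this is the case and condition on
the lowest crossing `c`: ... the sites above `c` have not been examined yet, thus remain
unbiased; RSW arguments then imply that with probability bounded below `c` is connected to the top
side by a black path included in `[-N/8, 0] × [-N, N]`, and another white path included in
`[0, N/8] × [-N, N]`".  Here, for `R = [0,M] × [0,N]` and the region `S* = dualBelowR M N ω` below
the lowest crossing:

* **heights** (deterministic): an open left–right crossing of `R` below the row `h₁ ≤ N` keeps
  `S*` strictly below the row `h₁` (`row_lt_of_mem_dualBelowR_of_openLR`, by the crossing lemma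
  `exists_dart_sepEdge_mem_edges`), and a closed-dual left–right face crossing of `R*` inside `S*`
  above the face row `h₀` keeps every above face at rows `≥ h₀`
  (`le_row_of_isAboveFace_of_dualLR`, by `exists_mem_support_of_crossing`); such a dual crossing
  lies inside `S*` as soon as it meets a closed-dual face path down to the bottom face row
  (`forall_mem_dualBelowR_of_dualLR_of_dualTB`);
* **the two column events given the data `S* = D₀`** (definitions): `attachCol M N D₀ a b` — an
  open path inside the column `a ≤ x₀ ≤ b` of `R` from the top side through vertices with no
  corner face in `D₀` to a vertex with a corner face in `D₀`; `dfootCol M N D₀ a b` — a closed-dual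
  face path inside the face column `a ≤ f₀ < b` of `R*` from the top face row through faces off
  `D₀` to a face adjacent to a face of `D₀`.  Both are determined by edges with no face in `D₀`
  (`determinedBy_attachCol`, `determinedBy_dfootCol`; these are disjoint from `belowEdges D₀`,
  which determines `{S* = D₀}`, `determinedBy_dualBelowR_eq`), both contain the full crossing of
  their column (`tbCrossingAt'_subset_attachCol`, `dualFaceCrossing_subset_dfootCol`), and on
  `{S* = D₀}` they produce an attachment `IsAttachedLow` resp. a dual foot `HasDualFootAt` at a
  vertex of the lowest crossing inside the column (`exists_isAttachedLow_of_attachCol`,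
  `exists_hasDualFootAt_of_dfootCol`).

## References

* P. Nolin, *Near-critical percolation in two dimensions*, EJP 13 (2008), §5.2, proof of
  Thm. 24 (ii) (arXiv 0711.4948: Thm. 23 (ii), p. 17) [Nolin2008].
* H. Kesten, *Scaling relations for 2D-percolation*, Comm. Math. Phys. 109 (1987), proof of
  Lemma 2 (the lowest crossing and the conditioning) [KestenScalingCMP1987].

## Tree

`ZdLowestFrontier.lean`, `ZdLowestFrontierFeet.lean`, `ZdFiveArmVertex.lean`; `lrCrossingAt`
(`CrossingChains.lean`), `tbCrossingAt'` (`ZdFiveArmQuasiMultOfSeparation.lean`), `dualFaceCrossing`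
(`ZdFiveArmPointBoundOfSeparation.lean`), `exists_dart_sepEdge_mem_edges`,
`exists_mem_support_of_crossing` (`PlanarDuality.lean`), `belowEdges` (`LowestCrossing.lean`).
-/

noncomputable section

open SimpleGraph Finset

namespace Literature.Probability.Percolation

open LatticeModels _root_.MeasureTheory

variable {M N : ℕ} {ω : BondConfig (Site 2)}

/-! ### Cutting a walk at a level -/

/-- **First visit to a level from below**: a lattice walk starting at `p` with `p i ≤ c` and having
a vertex with `i`-th coordinate `≥ c` contains an initial piece from `p` to a vertex of the level
`{x_i = c}` all of whose vertices have `x_i ≤ c`. [folklore] -/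
theorem exists_walk_to_level {p q : Site 2} (Q : (zdGraph 2).Walk p q) (i : Fin 2) (c : ℤ) (hp : p i ≤ c)
    (hz : ∃ z ∈ Q.support, c ≤ z i) :
    ∃ (q₁ : Site 2) (S : (zdGraph 2).Walk p q₁), q₁ i = c ∧ (∀ w ∈ S.support, w ∈ Q.support) ∧
      (∀ e ∈ S.edges, e ∈ Q.edges) ∧ ∀ w ∈ S.support, w i ≤ c := by
  classical
  obtain ⟨z, hz, hzc⟩ := hz
  obtain ⟨w₁, hw₁, hw₁c⟩ := exists_mem_support_apply_eq (Q.takeUntil z hz) i c hp hzc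
  have hw₁Q : w₁ ∈ Q.support := Q.support_takeUntil_subset_support hz hw₁
  obtain ⟨q₁, hq₁O, S, hSs, hSe, hSd⟩ :=
    exists_prefix_first_mem (O := {w : Site 2 | w i = c}) Q ⟨w₁, hw₁Q, hw₁c⟩
  have hq₁ : q₁ i = c := hq₁O
  refine ⟨q₁, S, hq₁, hSs, hSe, fun w hw => ?_⟩
  by_contra hgt
  push Not at hgt
  obtain ⟨u, hu, huc⟩ := exists_mem_support_apply_eq (S.takeUntil w hw) i c hp hgt.le
  have h := (S.takeUntil w hw).map_fst_darts_append
  rw [← h, List.mem_append, List.mem_singleton] at hu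
  rcases hu with hu | rfl
  · obtain ⟨d, hd, rfl⟩ := List.mem_map.1 hu
    exact hSd d (S.darts_takeUntil_subset_darts hw hd) huc
  · omega

/-- **First visit to a level from above**: a lattice walk starting at `p` with `c ≤ p i` and having
a vertex with `i`-th coordinate `≤ c` contains an initial piece from `p` to a vertex of the level
`{x_i = c}` all of whose vertices have `c ≤ x_i`. [folklore] -/
theorem exists_walk_to_level' {p q : Site 2} (Q : (zdGraph 2).Walk p q) (i : Fin 2) (c : ℤ) (hp : c ≤ p i)
    (hz : ∃ z ∈ Q.support, z i ≤ c) :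
    ∃ (q₁ : Site 2) (S : (zdGraph 2).Walk p q₁), q₁ i = c ∧ (∀ w ∈ S.support, w ∈ Q.support) ∧
      (∀ e ∈ S.edges, e ∈ Q.edges) ∧ ∀ w ∈ S.support, c ≤ w i := by
  classical
  obtain ⟨z, hz, hzc⟩ := hz
  obtain ⟨w₁, hw₁, hw₁c⟩ := exists_mem_support_apply_eq (Q.takeUntil z hz).reverse i c hzc hp
  have hw₁Q : w₁ ∈ Q.support := Q.support_takeUntil_subset_support hz (by simpa using hw₁)
  obtain ⟨q₁, hq₁O, S, hSs, hSe, hSd⟩ :=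
    exists_prefix_first_mem (O := {w : Site 2 | w i = c}) Q ⟨w₁, hw₁Q, hw₁c⟩
  have hq₁ : q₁ i = c := hq₁O
  refine ⟨q₁, S, hq₁, hSs, hSe, fun w hw => ?_⟩
  by_contra hlt
  push Not at hlt
  obtain ⟨u, hu, huc⟩ := exists_mem_support_apply_eq (S.takeUntil w hw).reverse i c hlt.le hp
  rw [Walk.support_reverse, List.mem_reverse] at hu
  have h := (S.takeUntil w hw).map_fst_darts_append
  rw [← h, List.mem_append, List.mem_singleton] at hu
  rcases hu with hu | rfl
  · obtain ⟨d, hd, rfl⟩ := List.mem_map.1 hu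
    exact hSd d (S.darts_takeUntil_subset_darts hw hd) huc
  · omega

/-! ### Dual-open face walks and the region below -/

/-- A face walk of `R*` along dual-open dual edges ending in `S*` lies in `S*`. [folklore] -/
theorem forall_mem_dualBelowR_of_walk_end {p q : Site 2} (Z : (zdGraph 2).Walk p q)
    (hZ : ∀ z ∈ Z.support, z ∈ dualRectangle M N) (hZd : ∀ e ∈ Z.edges, e ∈ dualConfig ω)
    (hq : q ∈ dualBelowR M N ω) : ∀ z ∈ Z.support, z ∈ dualBelowR M N ω := by
  classical
  intro z hz
  obtain ⟨hqD, b, hb, hconn⟩ := mem_dualBelowR_iff.1 hq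
  have h1 : dualConfig ω ∈ openConnIn (↑(dualRectangle M N) : Set (Site 2)) q z := by
    refine mem_openConnIn_of_walk (Z.dropUntil z hz).reverse
      (fun w hw => Finset.mem_coe.2 (hZ w (Z.support_dropUntil_subset_support _ (by simpa using hw)))) ?_
    intro e he
    apply hZd
    rw [Walk.edges_reverse, List.mem_reverse] at he
    exact Z.edges_dropUntil_subset_edges hz he
  exact mem_dualBelowR_iff.2 ⟨hZ z hz, b, hb, PlanarDuality.openConnIn_trans hconn h1⟩

/-- A face walk of `R*` along dual-open dual edges starting in `S*` lies in `S*`. [folklore] -/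
theorem forall_mem_dualBelowR_of_walk_start {p q : Site 2} (Z : (zdGraph 2).Walk p q)
    (hZ : ∀ z ∈ Z.support, z ∈ dualRectangle M N) (hZd : ∀ e ∈ Z.edges, e ∈ dualConfig ω)
    (hp : p ∈ dualBelowR M N ω) : ∀ z ∈ Z.support, z ∈ dualBelowR M N ω := fun z hz =>
  forall_mem_dualBelowR_of_walk_end Z.reverse (fun w hw => hZ w (by simpa using hw))
    (fun e he => hZd e (by simpa using he)) hp z (by simpa using hz)

/-- Closed primal edge between adjacent faces means dual-open dual edge (lattice configurations).
[folklore] -/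
theorem mk_mem_dualConfig_of_sepEdge_notMem (hω : ω ⊆ (zdGraph 2).edgeSet) {z z' : Site 2}
    (h : (zdGraph 2).Adj z z') (he : sepEdge z z' ∉ ω) : s(z, z') ∈ dualConfig ω :=
  (mem_dualConfig_mk_iff hω h).2 he

/-! ### Heights: an open crossing keeps `S*` low -/

/-- **An open left–right crossing below the row `h₁` keeps `S*` strictly below the row `h₁`.**  If
`ω` has an open walk from the left to the right side of `R` inside the rows `[0, h₁]` (`h₁ ≤ N`),
then every face of `S* = dualBelowR M N ω` has row `< h₁`: the closed-dual path from the bottom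
face row to a face of row `≥ h₁`, cut at its first visit to the face row `h₁`, is a dual top–bottom
crossing of `[0,M] × [0,h₁]`, and crosses an edge of the open walk
(`exists_dart_sepEdge_mem_edges`). [cite: Nolin2008, §5.2, proof of Thm. 24 (ii) ("a LR black crossing in the strip [-N,N] × [-N/2,N/2]")] -/
theorem row_lt_of_mem_dualBelowR_of_openLR (hω : ω ⊆ (zdGraph 2).edgeSet) {h₁ : ℕ}
    {x y : Site 2} (T : (zdGraph 2).Walk x y) (hx : x 0 = 0) (hy : y 0 = M)
    (hT : ∀ z ∈ T.support, 0 ≤ z 0 ∧ z 0 ≤ M ∧ 0 ≤ z 1 ∧ z 1 ≤ h₁) (hTω : ∀ e ∈ T.edges, e ∈ ω) :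
    ∀ g ∈ dualBelowR M N ω, g 1 < h₁ := by
  classical
  intro g hg
  by_contra hge
  push Not at hge
  obtain ⟨hgD, b, hb, hconn⟩ := mem_dualBelowR_iff.1 hg
  have hω' : dualConfig ω ⊆ (zdGraph 2).edgeSet := fun _ h => h.1
  obtain ⟨Z, hZs, hZe⟩ := exists_walk_of_mem_openConnIn hω' hconn
  have hb1 : b 1 = -1 := (Finset.mem_filter.1 hb).2
  -- cut at the first visit to the face row `h₁`
  obtain ⟨z₁, S, hz₁, hSs, hSe, hSle⟩ := exists_walk_to_level Z 1 h₁ (by omega) ⟨g, Z.end_mem_support, hge⟩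
  have hSR : ∀ w ∈ S.support, 0 ≤ w 0 ∧ w 0 + 1 ≤ M ∧ -1 ≤ w 1 ∧ w 1 ≤ h₁ := by
    intro w hw
    have := mem_dualRectangle_iff.1 (Finset.mem_coe.1 (hZs w (hSs w hw)))
    have := hSle w hw
    omega
  obtain ⟨d, hd, hde⟩ := exists_dart_sepEdge_mem_edges (M := M) (N := h₁) T S.reverse hT
    (fun w hw => hSR w (by simpa using hw)) hx hy hz₁ hb1
  have hclosed : sepEdge d.fst d.snd ∉ ω := by
    have h0 : d.edge ∈ S.edges := by
      have : d.edge ∈ S.reverse.edges := List.mem_map_of_mem hd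
      rw [Walk.edges_reverse, List.mem_reverse] at this
      exact this
    have h1 : d.edge ∈ dualConfig ω := hZe _ (hSe _ h0)
    exact (mem_dualConfig_mk_iff hω d.adj).1 h1
  exact hclosed (hTω _ hde)

/-! ### Heights: a dual crossing inside `S*` keeps the above faces high -/

/-- **A closed-dual left–right face crossing inside `S*` above the face row `h₀` keeps every above
face at rows `≥ h₀`.**  If the faces of a face walk from the face column `0` to the face column
`M - 1` inside the face rows `[h₀, h₀ + H]` (`h₀ + H ≤ N`) all lie in `S*`, then every above face
has row `≥ h₀`: the off-`S*` face path from the top face row to an above face of row `< h₀`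
contains a top–bottom crossing of the band, which meets the walk
(`exists_mem_support_of_crossing`). [cite: Nolin2008, §5.2, proof of Thm. 24 (ii)] -/
theorem le_row_of_isAboveFace_of_dualLR {h₀ H : ℕ} (hH : h₀ + H ≤ N) {l r : Site 2}
    (ζ : (zdGraph 2).Walk l r) (hl : l 0 = 0) (hr : r 0 = (M : ℤ) - 1)
    (hζ : ∀ z ∈ ζ.support, 0 ≤ z 0 ∧ z 0 ≤ (M : ℤ) - 1 ∧ (h₀ : ℤ) ≤ z 1 ∧ z 1 ≤ h₀ + H)
    (hζS : ∀ z ∈ ζ.support, z ∈ dualBelowR M N ω) {f : Site 2} (hf : IsAboveFace M N ω f) :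
    (h₀ : ℤ) ≤ f 1 := by
  classical
  by_contra hlt
  push Not at hlt
  obtain ⟨t, ht, A, hA⟩ := hf.exists_walk
  have ht1 : t 1 = N := (Finset.mem_filter.1 ht).2
  -- `A.reverse : f → t` climbs from below `h₀` to `N ≥ h₀ + H`; cut at the first visit to `h₀ + H`
  obtain ⟨z₁, S₁, hz₁, hS₁s, -, hS₁le⟩ := exists_walk_to_level A.reverse 1 (h₀ + H) (by omega)
    ⟨t, by simp, by omega⟩
  -- then descend from `z₁` to the first visit to `h₀`
  obtain ⟨z₂, S₂, hz₂, hS₂s, -, hS₂ge⟩ := exists_walk_to_level' S₁.reverse 1 h₀ (by omega)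
    ⟨f, by simp, hlt.le⟩
  have hS₂A : ∀ w ∈ S₂.support, w ∈ A.support := fun w hw => by
    have := hS₁s w (by simpa using hS₂s w hw); simpa using this
  have hS₂band : ∀ w ∈ S₂.support, 0 ≤ w 0 ∧ w 0 ≤ (M : ℤ) - 1 ∧ (h₀ : ℤ) ≤ w 1 ∧ w 1 ≤ h₀ + H := by
    intro w hw
    have h1 := mem_dualRectangle_iff.1 (hA w (hS₂A w hw)).1
    have h2 := hS₂ge w hw
    have h3 := hS₁le w (by simpa using hS₂s w hw)
    omega
  obtain ⟨c, hcζ, hcS⟩ := exists_mem_support_of_crossing (L := 0) (R := (M : ℤ) - 1) (B := h₀) (T := h₀ + H)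
    ζ S₂.reverse hζ (fun w hw => hS₂band w (by simpa using hw)) hl hr hz₂ hz₁
  have hcA : c ∈ A.support := hS₂A c (by simpa using hcS)
  exact (hA c hcA).2 (hζS c hcζ)

/-- **A closed-dual left–right face crossing meeting a closed-dual face path down to the bottom
face row lies in `S*`.**  Face walks `ζ` (from the face column `0` to the face column `M-1` inside
the face rows `[h₀, h₀+H]`, `h₀ + H ≤ N`) and `η` (from the face row `h₀ + H` to the bottom face
row `-1` inside `[0, M-1] × [-1, h₀+H]`), both crossing only closed edges of the lattice
configuration `ω`: then every face of `ζ` is in `dualBelowR M N ω` (`η` lies in `S*`, and meets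
`ζ` by `exists_mem_support_of_crossing`). [folklore] -/
theorem forall_mem_dualBelowR_of_dualLR_of_dualTB (hω : ω ⊆ (zdGraph 2).edgeSet) {h₀ H : ℕ} (hH : h₀ + H ≤ N)
    {l r : Site 2} (ζ : (zdGraph 2).Walk l r) (hl : l 0 = 0) (hr : r 0 = (M : ℤ) - 1)
    (hζ : ∀ z ∈ ζ.support, 0 ≤ z 0 ∧ z 0 ≤ (M : ℤ) - 1 ∧ (h₀ : ℤ) ≤ z 1 ∧ z 1 ≤ h₀ + H)
    (hζc : ∀ d ∈ ζ.darts, sepEdge d.fst d.snd ∉ ω)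
    {t s : Site 2} (η : (zdGraph 2).Walk t s) (ht : t 1 = h₀ + H) (hs : s 1 = -1)
    (hη : ∀ z ∈ η.support, 0 ≤ z 0 ∧ z 0 ≤ (M : ℤ) - 1 ∧ -1 ≤ z 1 ∧ z 1 ≤ h₀ + H)
    (hηc : ∀ d ∈ η.darts, sepEdge d.fst d.snd ∉ ω) :
    ∀ z ∈ ζ.support, z ∈ dualBelowR M N ω := by
  classical
  have hdual : ∀ {p q : Site 2} (W : (zdGraph 2).Walk p q), (∀ d ∈ W.darts, sepEdge d.fst d.snd ∉ ω) →
      ∀ e ∈ W.edges, e ∈ dualConfig ω := by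
    intro p q W hW e he
    rw [Walk.edges, List.mem_map] at he
    obtain ⟨d, hd, rfl⟩ := he
    exact mk_mem_dualConfig_of_sepEdge_notMem hω d.adj (hW d hd)
  have hηR : ∀ z ∈ η.support, z ∈ dualRectangle M N := fun z hz => by
    have := hη z hz; exact mem_dualRectangle_iff.2 ⟨this.1, this.2.1, this.2.2.1, by omega⟩
  have hζR : ∀ z ∈ ζ.support, z ∈ dualRectangle M N := fun z hz => by
    have := hζ z hz; exact mem_dualRectangle_iff.2 ⟨this.1, this.2.1, by omega, by omega⟩
  -- `η` lies in `S*`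
  have hsB : s ∈ dualBelowR M N ω := by
    have := hη s η.end_mem_support
    exact mem_dualBelowR_of_mem_dualBottomSide (Finset.mem_filter.2 ⟨hηR s η.end_mem_support, hs⟩)
  have hηS := forall_mem_dualBelowR_of_walk_end η hηR (hdual η hηc) hsB
  -- `η` crosses the band from its top row down to its bottom row: cut at the first visit to `h₀`
  obtain ⟨z₂, S, hz₂, hSs, -, hSge⟩ := exists_walk_to_level' η 1 h₀ (by omega) ⟨s, η.end_mem_support, by omega⟩
  have hSband : ∀ w ∈ S.support, 0 ≤ w 0 ∧ w 0 ≤ (M : ℤ) - 1 ∧ (h₀ : ℤ) ≤ w 1 ∧ w 1 ≤ h₀ + H := by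
    intro w hw
    have := hη w (hSs w hw); have := hSge w hw; omega
  obtain ⟨c, hcζ, hcS⟩ := exists_mem_support_of_crossing (L := 0) (R := (M : ℤ) - 1) (B := h₀) (T := h₀ + H)
    ζ S.reverse hζ (fun w hw => hSband w (by simpa using hw)) hl hr hz₂ ht
  have hcB : c ∈ dualBelowR M N ω := hηS c (hSs c (by simpa using hcS))
  -- spread along `ζ` from `c`
  intro z hz
  have hzζ' : z ∈ (ζ.takeUntil c hcζ).support ∨ z ∈ (ζ.dropUntil c hcζ).support := by
    rw [← Walk.mem_support_append_iff, Walk.take_spec]; exact hz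
  rcases hzζ' with hz' | hz'
  · exact forall_mem_dualBelowR_of_walk_end (ζ.takeUntil c hcζ)
      (fun w hw => hζR w (ζ.support_takeUntil_subset_support hcζ hw))
      (fun e he => hdual ζ hζc e (ζ.edges_takeUntil_subset_edges hcζ he)) hcB z hz'
  · exact forall_mem_dualBelowR_of_walk_start (ζ.dropUntil c hcζ)
      (fun w hw => hζR w (ζ.support_dropUntil_subset_support hcζ hw))
      (fun e he => hdual ζ hζc e (ζ.edges_dropUntil_subset_edges hcζ he)) hcB z hz'

/-! ### Vertices read along a walk -/

/-- A property of the starts of the darts of a walk holds at every vertex `U.getVert n`, `n < |U|`.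
[folklore] -/
theorem of_darts_getVert {V : Type*} {G : SimpleGraph V} {p q : V} (U : G.Walk p q) {P : V → Prop}
    (hU : ∀ d ∈ U.darts, P d.fst) {n : ℕ} (hn : n < U.length) : P (U.getVert n) := by
  have h : n < U.darts.length := by rwa [SimpleGraph.Walk.length_darts]
  have := hU _ (List.getElem_mem h)
  rwa [SimpleGraph.Walk.darts_getElem_eq_getVert n h] at this

/-- Consecutive vertices of a walk span one of its edges. [folklore] -/
theorem mk_getVert_succ_mem_edges {V : Type*} {G : SimpleGraph V} {p q : V} (U : G.Walk p q) {k : ℕ}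
    (hk : k < U.length) : s(U.getVert k, U.getVert (k + 1)) ∈ U.edges := by
  have hlen : k < U.darts.length := by rw [SimpleGraph.Walk.length_darts]; exact hk
  have hd : U.darts[k] ∈ U.darts := List.getElem_mem hlen
  rw [SimpleGraph.Walk.darts_getElem_eq_getVert k hlen] at hd
  exact List.mem_map.2 ⟨_, hd, rfl⟩

/-! ### The attachment column event -/

/-- **The attachment column event given the data `D₀`** (the value of `S*`): an open path inside
the column `a ≤ x₀ ≤ b` of `R` from the top side, through vertices none of whose corner faces is in
`D₀`, to a vertex with a corner face in `D₀` (Nolin: "`c` is connected to the top side by a black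
path included in `[-N/8, 0] × [-N, N]`", in the form read off the unexplored edges).
[cite: Nolin2008, §5.2, proof of Thm. 24 (ii) (arXiv 0711.4948: Thm. 23 (ii), p. 17)] -/
def attachCol (M N : ℕ) (D₀ : Finset (Site 2)) (a b : ℤ) : Set (BondConfig (Site 2)) :=
  {ω | ∃ t ∈ topSide M N, ∃ (u : Site 2) (U : (zdGraph 2).Walk t u),
      (∀ z ∈ U.support, z ∈ rectangle M N ∧ a ≤ z 0 ∧ z 0 ≤ b) ∧
      (∀ d ∈ U.darts, ∀ f ∈ cornerFaces d.fst, f ∉ D₀) ∧ (∃ f ∈ cornerFaces u, f ∈ D₀) ∧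
      ∀ e ∈ U.edges, e ∈ ω}

open Classical in
/-- The edges read by `attachCol M N D₀ a b`: pairs of sites of the column none of whose two faces
is in `D₀`. [folklore] -/
def attachColEdges (M N : ℕ) (D₀ : Finset (Site 2)) (a b : ℤ) : Finset (Sym2 (Site 2)) :=
  ((rectangle M N).filter fun z => a ≤ z 0 ∧ z 0 ≤ b).sym2.filter fun e => ∀ f ∈ D₀, f ∉ dualEdge e

/-- The edges of a walk of the attachment event are read edges. [folklore] -/
theorem edges_subset_attachColEdges {D₀ : Finset (Site 2)} {a b : ℤ} {t u : Site 2} (U : (zdGraph 2).Walk t u)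
    (hUs : ∀ z ∈ U.support, z ∈ rectangle M N ∧ a ≤ z 0 ∧ z 0 ≤ b)
    (hUd : ∀ d ∈ U.darts, ∀ f ∈ cornerFaces d.fst, f ∉ D₀) :
    ∀ e ∈ U.edges, e ∈ attachColEdges M N D₀ a b := by
  classical
  intro e he
  rw [Walk.edges, List.mem_map] at he
  obtain ⟨d, hd, rfl⟩ := he
  rw [attachColEdges, Finset.mem_filter, Finset.mem_sym2_iff]
  refine ⟨fun z hz => Finset.mem_filter.2 ?_, fun f hf hfe => hUd d hd f ?_ hf⟩
  · rcases Sym2.mem_iff.1 hz with rfl | rfl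
    · exact hUs _ (U.dart_fst_mem_support_of_mem_darts hd)
    · exact hUs _ (U.dart_snd_mem_support_of_mem_darts hd)
  · exact cornerFaces_of_mem_dualEdge d.edge_mem (Sym2.mem_mk_left _ _) hfe

/-- **`attachCol M N D₀ a b` is determined by `attachColEdges M N D₀ a b`.** [folklore] -/
theorem determinedBy_attachCol (M N : ℕ) (D₀ : Finset (Site 2)) (a b : ℤ) :
    DeterminedBy (attachCol M N D₀ a b) ↑(attachColEdges M N D₀ a b) := by
  suffices key : ∀ ω ω' : BondConfig (Site 2), ω ∩ ↑(attachColEdges M N D₀ a b) = ω' ∩ ↑(attachColEdges M N D₀ a b) →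
      ω' ∈ attachCol M N D₀ a b → ω ∈ attachCol M N D₀ a b by
    rw [determinedBy_iff]
    exact fun ω ω' h => ⟨key ω' ω h.symm, key ω ω' h⟩
  rintro ω ω' h ⟨t, ht, u, U, hUs, hUd, hu, hUe⟩
  exact ⟨t, ht, u, U, hUs, hUd, hu, fun e he => mem_of_inter_eq h.symm (edges_subset_attachColEdges U hUs hUd e he) (hUe e he)⟩

/-- The attachment event is measurable. [folklore] -/
theorem measurableSet_attachCol (M N : ℕ) (D₀ : Finset (Site 2)) (a b : ℤ) : MeasurableSet (attachCol M N D₀ a b) :=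
  (determinedBy_attachCol M N D₀ a b).measurableSet_of_finset

/-- The read edges of the attachment event have no face in `D₀`, so they are disjoint from
`belowEdges D₀`. [folklore] -/
theorem disjoint_belowEdges_attachColEdges (M N : ℕ) (D₀ : Finset (Site 2)) (a b : ℤ) :
    Disjoint (belowEdges D₀) (attachColEdges M N D₀ a b) := by
  classical
  rw [Finset.disjoint_left]
  intro e he he'
  obtain ⟨g, hg, hge⟩ := Finset.mem_biUnion.1 he
  exact (Finset.mem_filter.1 he').2 g hg (mem_dualEdge_of_mem_squareEdges hge)

/-- **A full open top–bottom crossing of the column gives the attachment event**, for every `D₀`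
containing the bottom face row: follow the crossing from the top side down to its first vertex
with a corner face in `D₀`. [folklore] -/
theorem mem_attachCol_of_tbCrossingAt' (hω : ω ⊆ (zdGraph 2).edgeSet) (hM : 1 ≤ M) {D₀ : Finset (Site 2)}
    (hD : ∀ x : ℤ, 0 ≤ x → x + 1 ≤ M → (![x, -1] : Site 2) ∈ D₀) {a : ℤ} {w : ℕ} (ha : 0 ≤ a) (haw : a + w ≤ M)
    (h : ω ∈ tbCrossingAt' ![a, 0] w N) : ω ∈ attachCol M N D₀ a (a + w) := by
  classical
  obtain ⟨x, y, T, hx, hy, hTs, hTe⟩ := exists_walk_of_mem_tbCrossingAt hω h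
  simp only [Matrix.cons_val_one, Matrix.cons_val_zero, zero_add] at hx hy hTs
  -- the bottom end `x` has a corner face in the bottom face row
  have hxO : ∃ f ∈ cornerFaces x, f ∈ D₀ := by
    have hx' := hTs x T.start_mem_support
    by_cases hxM : x 0 + 1 ≤ M
    · refine ⟨x - Pi.single 1 1, ZdCorner.SE_mem x, ?_⟩
      have : x - Pi.single 1 1 = ![x 0, -1] := by
        ext i; fin_cases i <;> simp [hx]
      rw [this]; exact hD _ (by omega) hxM
    · refine ⟨x - Pi.single 0 1 - Pi.single 1 1, ZdCorner.SW_mem x, ?_⟩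
      have : x - Pi.single 0 1 - Pi.single 1 1 = ![x 0 - 1, -1] := by
        ext i; fin_cases i <;> simp [hx]
      rw [this]; exact hD _ (by omega) (by omega)
  obtain ⟨u, huO, U, hUs, hUe, hUd⟩ := exists_prefix_first_mem (O := {z : Site 2 | ∃ f ∈ cornerFaces z, f ∈ D₀})
    T.reverse ⟨x, by simp, hxO⟩
  have hyT : y ∈ topSide M N := by
    have := hTs y T.end_mem_support
    exact Finset.mem_filter.2 ⟨mem_rectangle_iff.2 ⟨by omega, by omega, by omega, by omega⟩, hy⟩
  refine ⟨y, hyT, u, U, fun z hz => ?_, fun d hd f hf hfD => hUd d hd ⟨f, hf, hfD⟩, huO, fun e he => hTe e ?_⟩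
  · have := hTs z (by simpa using hUs z hz)
    exact ⟨mem_rectangle_iff.2 ⟨by omega, by omega, by omega, by omega⟩, this.1, this.2.1⟩
  · simpa using hUe e he

/-- The full crossing of the column is contained in the attachment event. [folklore] -/
theorem inter_tbCrossingAt'_subset_attachCol (hM : 1 ≤ M) {D₀ : Finset (Site 2)}
    (hD : ∀ x : ℤ, 0 ≤ x → x + 1 ≤ M → (![x, -1] : Site 2) ∈ D₀) {a : ℤ} {w : ℕ} (ha : 0 ≤ a) (haw : a + w ≤ M) :
    {ω | ω ⊆ (zdGraph 2).edgeSet} ∩ tbCrossingAt' ![a, 0] w N ⊆ attachCol M N D₀ a (a + w) :=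
  fun _ h => mem_attachCol_of_tbCrossingAt' h.1 hM hD ha haw h.2

/-- **On `{S* = D₀}` the attachment event attaches the lowest crossing to the top side inside the
column**: the vertices of the path have no corner face below, hence (from the top side on, where
the top face row is above) are above vertices joined to the top side; its last vertex, adjacent
to an above vertex and with a corner face below, is a vertex of the lowest crossing. Assumes that
the top face row is off `S*` and that no low vertex lies on the top side. [cite: Nolin2008, §5.2, proof of Thm. 24 (ii) (arXiv 0711.4948: Thm. 23 (ii), p. 17)] -/
theorem exists_isAttachedLow_of_attachCol (hM : 1 ≤ M) (hT : ∀ t ∈ dualTopSide M N, t ∉ dualBelowR M N ω)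
    (hSrow : ∀ g ∈ dualBelowR M N ω, g 1 + 1 < N) (Λ : LowPath M N ω) {a b : ℤ}
    (h : ω ∈ attachCol M N (dualBelowR M N ω) a b) :
    ∃ i, i ≤ Λ.path.length ∧ IsAttachedLow M N ω (Λ.path.getVert i) ∧ a ≤ Λ.path.getVert i 0 ∧ Λ.path.getVert i 0 ≤ b := by
  classical
  obtain ⟨t, ht, u, U, hUs, hUd, ⟨f, hf, hfD⟩, hUe⟩ := h
  have htR : t ∈ rectangle M N := (Finset.mem_filter.1 ht).1
  have htN : t 1 = N := (Finset.mem_filter.1 ht).2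
  have hnotlow : ∀ {z : Site 2}, (∀ g ∈ cornerFaces z, g ∉ dualBelowR M N ω) → ¬ IsLowVertex M N ω z := by
    intro z hz hl
    obtain ⟨g, hg, hgB⟩ := hl.exists_cornerFace_mem
    exact hz g hg hgB
  -- no corner face of the top-side vertex `t` is below (they have rows `N - 1`, `N`)
  have htno : ∀ g ∈ cornerFaces t, g ∉ dualBelowR M N ω := by
    intro g hg hgB
    have := hSrow g hgB
    rcases eq_of_mem_cornerFaces hg with rfl | rfl | rfl | rfl <;> simp [htN] at this ⊢
  -- so `U` is not nil
  have hlen : 0 < U.length := by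
    by_contra h0
    push Not at h0
    have h0' : U.length = 0 := Nat.le_zero.1 h0
    have htu : t = u := by
      have := U.getVert_length; rw [h0'] at this; simpa using this
    subst htu
    exact htno f hf hfD
  -- every dart start is above and joined to the top side
  have habv : ∀ n, n < U.length → IsTopJoinedAbove M N ω (U.getVert n) := by
    intro n
    induction n with
    | zero =>
      intro _
      rw [Walk.getVert_zero]
      -- the top face `(t₀, N)` or `(t₀ - 1, N)` around `t` is above
      have htR' := mem_rectangle_iff.1 htR
      obtain ⟨z, hz, hzT⟩ : ∃ z ∈ cornerFaces t, z ∈ dualTopSide M N := by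
        by_cases h0 : t 0 + 1 ≤ M
        · refine ⟨t, ZdCorner.NE_mem t, Finset.mem_filter.2 ⟨mem_dualRectangle_iff.2 ⟨?_, ?_, ?_, ?_⟩, htN⟩⟩ <;> omega
        · refine ⟨t - Pi.single 0 1, ZdCorner.NW_mem t, Finset.mem_filter.2 ⟨mem_dualRectangle_iff.2 ⟨?_, ?_, ?_, ?_⟩, ?_⟩⟩ <;>
            simp <;> omega
      have habove : IsAboveVertex M N ω t :=
        isAboveVertex_of_forall_not_mem htR htno ⟨z, hz, isAboveFace_of_mem_dualTopSide hzT (hT z hzT)⟩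
      exact ⟨t, ht, Walk.nil, by simpa using habove, by simp⟩
    | succ n ih =>
      intro hn
      have hprev := ih (by omega)
      have hadj : (zdGraph 2).Adj (U.getVert n) (U.getVert (n + 1)) := U.adj_getVert_succ (by omega)
      have hedge : s(U.getVert n, U.getVert (n + 1)) ∈ ω := hUe _ (mk_getVert_succ_mem_edges U (by omega))
      have hcur := of_darts_getVert U (P := fun z => ∀ g ∈ cornerFaces z, g ∉ dualBelowR M N ω) hUd hn
      have hR := (hUs _ (U.getVert_mem_support (n + 1))).1
      exact hprev.of_adj hadj hedge (hprev.isAboveVertex.of_adj hM hR hadj (hnotlow hcur))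
  -- the last dart attaches `u`
  set t' := U.getVert (U.length - 1) with ht'
  have ht'j : IsTopJoinedAbove M N ω t' := habv _ (by omega)
  have hadj : (zdGraph 2).Adj t' u := by
    have := U.adj_getVert_succ (i := U.length - 1) (by omega)
    rwa [Nat.sub_add_cancel hlen, Walk.getVert_length] at this
  have hedge : s(t', u) ∈ ω := by
    have := mk_getVert_succ_mem_edges U (k := U.length - 1) (by omega)
    rw [Nat.sub_add_cancel hlen, Walk.getVert_length] at this
    exact hUe _ this
  have huR := (hUs u U.end_mem_support).1
  -- `u` is low: it is not above (corner face below) and adjacent to an above vertex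
  have hulow : IsLowVertex M N ω u := by
    by_contra hnl
    exact (ht'j.isAboveVertex.of_adj hM huR hadj hnl).not_mem_of_cornerFaces hf hfD
  obtain ⟨i, hi, hiu⟩ : ∃ i, i ≤ Λ.path.length ∧ Λ.path.getVert i = u := by
    have := (Λ.mem_support_iff hM).2 hulow
    rw [Walk.mem_support_iff_exists_getVert] at this
    obtain ⟨i, h1, h2⟩ := this
    exact ⟨i, h2, h1⟩
  refine ⟨i, hi, ?_, ?_, ?_⟩
  · rw [hiu]; exact ⟨t', ht'j, hadj, hedge⟩
  · rw [hiu]; exact (hUs u U.end_mem_support).2.1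
  · rw [hiu]; exact (hUs u U.end_mem_support).2.2

/-! ### The dual-foot column event -/

/-- **The dual-foot column event given the data `D₀`**: a face path inside the face column
`a ≤ f₀ < b` of `R*` from the top face row, through faces off `D₀`, to a face adjacent to a face
of `D₀` inside `R*`, every step of which crosses a closed edge (Nolin: "another white path included
in `[0, N/8] × [-N, N]`" from the top side to the lowest crossing, in the form read off the
unexplored edges). [cite: Nolin2008, §5.2, proof of Thm. 24 (ii) (arXiv 0711.4948: Thm. 23 (ii), p. 17)] -/
def dfootCol (M N : ℕ) (D₀ : Finset (Site 2)) (a b : ℤ) : Set (BondConfig (Site 2)) :=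
  {ω | ∃ t ∈ dualTopSide M N, ∃ (φ g : Site 2) (Y : (zdGraph 2).Walk t φ),
      (∀ z ∈ Y.support, z ∈ dualRectangle M N ∧ a ≤ z 0 ∧ z 0 + 1 ≤ b ∧ z ∉ D₀) ∧
      g ∈ D₀ ∧ g ∈ dualRectangle M N ∧ (zdGraph 2).Adj φ g ∧
      ∀ d ∈ Y.darts, sepEdge d.fst d.snd ∉ ω}

open Classical in
/-- The edges read by `dfootCol M N D₀ a b`: the edges between adjacent faces of the face column
off `D₀`. [folklore] -/
def dfootColEdges (M N : ℕ) (D₀ : Finset (Site 2)) (a b : ℤ) : Finset (Sym2 (Site 2)) :=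
  ((((dualRectangle M N).filter fun z => a ≤ z 0 ∧ z 0 + 1 ≤ b ∧ z ∉ D₀) ×ˢ
      ((dualRectangle M N).filter fun z => a ≤ z 0 ∧ z 0 + 1 ≤ b ∧ z ∉ D₀)).filter
      fun p => (zdGraph 2).Adj p.1 p.2).image fun p => sepEdge p.1 p.2

/-- The edges crossed by a face walk of the dual-foot event are read edges. [folklore] -/
theorem sepEdge_mem_dfootColEdges {D₀ : Finset (Site 2)} {a b : ℤ} {t φ : Site 2} (Y : (zdGraph 2).Walk t φ)
    (hYs : ∀ z ∈ Y.support, z ∈ dualRectangle M N ∧ a ≤ z 0 ∧ z 0 + 1 ≤ b ∧ z ∉ D₀) :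
    ∀ d ∈ Y.darts, sepEdge d.fst d.snd ∈ dfootColEdges M N D₀ a b := by
  classical
  intro d hd
  rw [dfootColEdges, Finset.mem_image]
  refine ⟨(d.fst, d.snd), Finset.mem_filter.2 ⟨Finset.mem_product.2 ⟨?_, ?_⟩, d.adj⟩, rfl⟩
  · have := hYs _ (Y.dart_fst_mem_support_of_mem_darts hd)
    exact Finset.mem_filter.2 ⟨this.1, this.2⟩
  · have := hYs _ (Y.dart_snd_mem_support_of_mem_darts hd)
    exact Finset.mem_filter.2 ⟨this.1, this.2⟩

/-- **`dfootCol M N D₀ a b` is determined by `dfootColEdges M N D₀ a b`.** [folklore] -/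
theorem determinedBy_dfootCol (M N : ℕ) (D₀ : Finset (Site 2)) (a b : ℤ) :
    DeterminedBy (dfootCol M N D₀ a b) ↑(dfootColEdges M N D₀ a b) := by
  suffices key : ∀ ω ω' : BondConfig (Site 2), ω ∩ ↑(dfootColEdges M N D₀ a b) = ω' ∩ ↑(dfootColEdges M N D₀ a b) →
      ω' ∈ dfootCol M N D₀ a b → ω ∈ dfootCol M N D₀ a b by
    rw [determinedBy_iff]
    exact fun ω ω' h => ⟨key ω' ω h.symm, key ω ω' h⟩
  rintro ω ω' h ⟨t, ht, φ, g, Y, hYs, hgD, hgR, hadj, hYc⟩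
  exact ⟨t, ht, φ, g, Y, hYs, hgD, hgR, hadj, fun d hd he =>
    hYc d hd (mem_of_inter_eq h (sepEdge_mem_dfootColEdges Y hYs d hd) he)⟩

/-- The dual-foot event is measurable. [folklore] -/
theorem measurableSet_dfootCol (M N : ℕ) (D₀ : Finset (Site 2)) (a b : ℤ) : MeasurableSet (dfootCol M N D₀ a b) :=
  (determinedBy_dfootCol M N D₀ a b).measurableSet_of_finset

/-- The read edges of the dual-foot event have no face in `D₀`, so they are disjoint from
`belowEdges D₀`. [folklore] -/
theorem disjoint_belowEdges_dfootColEdges (M N : ℕ) (D₀ : Finset (Site 2)) (a b : ℤ) :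
    Disjoint (belowEdges D₀) (dfootColEdges M N D₀ a b) := by
  classical
  rw [Finset.disjoint_left]
  intro e he he'
  obtain ⟨g, hg, hge⟩ := Finset.mem_biUnion.1 he
  obtain ⟨p, hp, rfl⟩ := Finset.mem_image.1 he'
  obtain ⟨hp12, hadj⟩ := Finset.mem_filter.1 hp
  obtain ⟨hp1, hp2⟩ := Finset.mem_product.1 hp12
  have hgd := mem_dualEdge_of_mem_squareEdges hge
  rw [dualEdge_sepEdge hadj] at hgd
  rcases Sym2.mem_iff.1 hgd with rfl | rfl
  · exact (Finset.mem_filter.1 hp1).2.2.2 hg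
  · exact (Finset.mem_filter.1 hp2).2.2.2 hg

/-- The read edges of the two column events in disjoint columns are disjoint: the attachment
column `[a, b]` (vertices) and the face column `[a', b')` with `b < a'`. [folklore] -/
theorem disjoint_attachColEdges_dfootColEdges (M N : ℕ) (D₀ : Finset (Site 2)) {a b a' b' : ℤ} (hba : b < a') :
    Disjoint (attachColEdges M N D₀ a b) (dfootColEdges M N D₀ a' b') := by
  classical
  rw [Finset.disjoint_left]
  intro e he he'
  obtain ⟨p, hp, rfl⟩ := Finset.mem_image.1 he'
  obtain ⟨hp12, hadj⟩ := Finset.mem_filter.1 hp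
  obtain ⟨hp1, -⟩ := Finset.mem_product.1 hp12
  have ha' := (Finset.mem_filter.1 hp1).2.1
  -- the lower end `p.1 ⊔ p.2` of the crossed edge has `x₀ ≥ a' > b`
  have hmem : p.1 ⊔ p.2 ∈ sepEdge p.1 p.2 := Sym2.mem_mk_left _ _
  have hx := (sepEdge_apply_le hmem).1.1
  have hcol := (Finset.mem_filter.1 ((Finset.mem_sym2_iff.1 (Finset.mem_filter.1 he).1) _ hmem)).2.2
  have : a' ≤ (p.1 ⊔ p.2) 0 := le_trans (by exact_mod_cast le_max_left _ _ |>.trans' ha') hx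
  omega

/-- Closedness of the crossed edges passes to sub-walks (through the edge lists). [folklore] -/
theorem sepEdge_notMem_of_edges_subset {p q p' q' : Site 2} {W : (zdGraph 2).Walk p q} {Y : (zdGraph 2).Walk p' q'}
    (hW : ∀ d ∈ W.darts, sepEdge d.fst d.snd ∉ ω) (hsub : ∀ e ∈ Y.edges, e ∈ W.edges) :
    ∀ d ∈ Y.darts, sepEdge d.fst d.snd ∉ ω := by
  intro d hd
  have he : d.edge ∈ W.edges := hsub _ (List.mem_map_of_mem hd)
  rw [Walk.edges, List.mem_map] at he
  obtain ⟨d', hd', hdd'⟩ := he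
  have := hW d' hd'
  rcases Sym2.eq_iff.1 (show s(d'.fst, d'.snd) = s(d.fst, d.snd) from hdd') with ⟨h1, h2⟩ | ⟨h1, h2⟩
  · rwa [h1, h2] at this
  · rwa [h1, h2, sepEdge_comm] at this

/-- **A full closed-dual top–bottom crossing of the face column gives the dual-foot event**, for
every `D₀` containing the bottom face row of `R*` and missing its top face row: follow the
crossing from the top face row to the face before its first face in `D₀`. [folklore] -/
theorem mem_dfootCol_of_dualFaceCrossing {D₀ : Finset (Site 2)}
    (hD : ∀ x : ℤ, 0 ≤ x → x + 1 ≤ M → (![x, -1] : Site 2) ∈ D₀) (hDtop : ∀ t ∈ dualTopSide M N, t ∉ D₀)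
    {a : ℤ} {w : ℕ} (ha : 0 ≤ a) (haw : a + w ≤ M) (h : ω ∈ dualFaceCrossing ![a, 0] w N) :
    ω ∈ dfootCol M N D₀ a (a + w) := by
  classical
  obtain ⟨t, s, W, ht, hs, hWs, hWc⟩ := h
  simp only [Matrix.cons_val_one, Matrix.cons_val_zero, zero_add, zero_sub] at ht hs hWs
  have hWR : ∀ z ∈ W.support, z ∈ dualRectangle M N := fun z hz => by
    have := hWs z hz; exact mem_dualRectangle_iff.2 ⟨by omega, by omega, this.2.2.1, this.2.2.2⟩
  have hsD : s ∈ D₀ := by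
    have hs' := hWs s W.end_mem_support
    have : s = ![s 0, -1] := by ext i; fin_cases i <;> simp [hs]
    rw [this]; exact hD _ (by omega) (by omega)
  have htT : t ∈ dualTopSide M N := Finset.mem_filter.2 ⟨hWR t W.start_mem_support, ht⟩
  -- the first face of `W` in `D₀`
  obtain ⟨g, hgD, W₁, hW₁s, hW₁e, hW₁d⟩ := exists_prefix_first_mem (O := {z : Site 2 | z ∈ D₀}) W ⟨s, W.end_mem_support, hsD⟩
  have hgD' : g ∈ D₀ := hgD
  have hlen : 0 < W₁.length := by
    by_contra h0
    push Not at h0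
    have h0' : W₁.length = 0 := Nat.le_zero.1 h0
    have htg : t = g := by
      have := W₁.getVert_length; rw [h0'] at this; simpa using this
    exact hDtop t htT (htg ▸ hgD')
  -- `Y` = `W₁` without its last step
  set Y := W₁.take (W₁.length - 1) with hY
  have hYsupp : ∀ z ∈ Y.support, z ∈ W₁.support ∧ z ∉ D₀ := by
    intro z hz
    obtain ⟨m, hm, hmL, rfl⟩ := exists_getVert_of_mem_support_take W₁ _ hz
    exact ⟨W₁.getVert_mem_support m, of_darts_getVert W₁ (P := fun z => z ∉ D₀) hW₁d (by omega)⟩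
  have hadj : (zdGraph 2).Adj (W₁.getVert (W₁.length - 1)) g := by
    have := W₁.adj_getVert_succ (i := W₁.length - 1) (by omega)
    rwa [Nat.sub_add_cancel hlen, Walk.getVert_length] at this
  refine ⟨t, htT, W₁.getVert (W₁.length - 1), g, Y, fun z hz => ?_, hgD', hWR g (hW₁s g W₁.end_mem_support), hadj, ?_⟩
  · obtain ⟨hzW₁, hzD⟩ := hYsupp z hz
    have := hWs z (hW₁s z hzW₁)
    exact ⟨hWR z (hW₁s z hzW₁), this.1, this.2.1, hzD⟩
  · exact sepEdge_notMem_of_edges_subset hWc fun e he => hW₁e e (edges_take_subset W₁ _ he)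

/-- The full dual crossing of the face column is contained in the dual-foot event. [folklore] -/
theorem dualFaceCrossing_subset_dfootCol {D₀ : Finset (Site 2)}
    (hD : ∀ x : ℤ, 0 ≤ x → x + 1 ≤ M → (![x, -1] : Site 2) ∈ D₀) (hDtop : ∀ t ∈ dualTopSide M N, t ∉ D₀)
    {a : ℤ} {w : ℕ} (ha : 0 ≤ a) (haw : a + w ≤ M) :
    dualFaceCrossing ![a, 0] w N ⊆ dfootCol M N D₀ a (a + w) :=
  fun _ h => mem_dfootCol_of_dualFaceCrossing hD hDtop ha haw h

/-- **On `{S* = D₀}` the dual-foot event gives a dual foot at a vertex of the lowest crossing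
inside the column** (up to one unit on the right): the faces of the path are above faces (off
`S*`, joined to the top face row off `S*`), so the edge between its last face and the adjacent
face of `S*` is a low edge, i.e. an edge of the lowest crossing, and the path is a dual-open face
path of `R*` from the top face row to a face around an endpoint of that edge. [cite: Nolin2008, §5.2, proof of Thm. 24 (ii) (arXiv 0711.4948: Thm. 23 (ii), p. 17)] -/
theorem exists_hasDualFootAt_of_dfootCol (hω : ω ⊆ (zdGraph 2).edgeSet) (Λ : LowPath M N ω) {a b : ℤ}
    (h : ω ∈ dfootCol M N (dualBelowR M N ω) a b) :
    ∃ j, j ≤ Λ.path.length ∧ HasDualFootAt M N ω (Λ.path.getVert j) ∧ a ≤ Λ.path.getVert j 0 ∧ Λ.path.getVert j 0 ≤ b + 1 := by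
  classical
  obtain ⟨t, ht, φ, g, Y, hYs, hgD, hgR, hadj, hYc⟩ := h
  -- `φ` is an above face
  have habove : IsAboveFace M N ω φ := by
    refine ⟨t, ht, mem_openConnIn_of_walk Y (fun z hz => ⟨(hYs z hz).1, (hYs z hz).2.2.2⟩) fun e he => Y.edges_subset_edgeSet he⟩
  -- the low edge between `g` and `φ` is an edge of the lowest crossing
  have hlow : IsLowEdge M N ω (sepEdge g φ) := ⟨g, φ, hadj.symm, hgD, habove, rfl⟩
  obtain ⟨k, hk, hke⟩ := Λ.exists_eq_mk_getVert ((Λ.mem_edges_iff _).2 hlow)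
  have hvk : Λ.path.getVert k ∈ sepEdge g φ := by rw [hke]; exact Sym2.mem_mk_left _ _
  have hφc : φ ∈ cornerFaces (Λ.path.getVert k) := (cornerFaces_of_mem_sepEdge hadj.symm hvk).2
  -- the dual-open face path
  have hdual : dualConfig ω ∈ openConnIn (↑(dualRectangle M N) : Set (Site 2)) t φ := by
    refine mem_openConnIn_of_walk Y (fun z hz => Finset.mem_coe.2 (hYs z hz).1) fun e he => ?_
    rw [Walk.edges, List.mem_map] at he
    obtain ⟨d, hd, rfl⟩ := he
    exact mk_mem_dualConfig_of_sepEdge_notMem hω d.adj (hYc d hd)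
  have hφ := hYs φ Y.end_mem_support
  have hx := (sepEdge_apply_le hvk).1
  have hg0 : φ 0 - 1 ≤ g 0 ∧ g 0 ≤ φ 0 + 1 := by
    rcases stepKind_of_adj hadj with ⟨h0, -⟩ | ⟨h0, -⟩ | ⟨-, h0⟩ | ⟨-, h0⟩ <;> omega
  refine ⟨k, hk.le, ⟨t, ht, φ, hφc, hdual⟩, ?_, ?_⟩
  · have : φ 0 ≤ max (g 0) (φ 0) := le_max_right _ _; omega
  · have : max (g 0) (φ 0) ≤ φ 0 + 1 := max_le hg0.2 (by omega); omega

/-! ### The good event and its probability -/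

/-- `IsAboveFace` depends on `ω` only through `S* = dualBelowR M N ω`. [folklore] -/
theorem isAboveFace_congr {ω ω' : BondConfig (Site 2)} (h : dualBelowR M N ω = dualBelowR M N ω') (f : Site 2) :
    IsAboveFace M N ω f ↔ IsAboveFace M N ω' f := by
  have : offBelow M N ω = offBelow M N ω' := by
    ext z; simp only [offBelow, Set.mem_setOf_eq, h]
  simp only [IsAboveFace, this]

/-- **The good event of the five-arm construction** with height window `[lo, hi)` and columns
`[a₁, b₁]` (attachment), `[a₂, b₂)` (dual foot): the top face row is off `S*`, the faces of `S*`
have rows `< hi`, the above faces have rows `≥ lo`, and both column events hold for the data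
`D₀ = S*`. [cite: Nolin2008, §5.2, proof of Thm. 24 (ii) (arXiv 0711.4948: Thm. 23 (ii), p. 17)] -/
def fiveArmGood (M N lo hi : ℕ) (a₁ b₁ a₂ b₂ : ℤ) : Set (BondConfig (Site 2)) :=
  {ω | (∀ t ∈ dualTopSide M N, t ∉ dualBelowR M N ω) ∧ (∀ g ∈ dualBelowR M N ω, g 1 < hi) ∧
       (∀ f, IsAboveFace M N ω f → (lo : ℤ) ≤ f 1) ∧
       ω ∈ attachCol M N (dualBelowR M N ω) a₁ b₁ ∧ ω ∈ dfootCol M N (dualBelowR M N ω) a₂ b₂}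

/-- **The environment**: an open left–right crossing of `R` inside the rows `[h', h' + H']`, a
closed-dual left–right face crossing of `R*` inside the face rows `[lo, lo + H]`, and a closed-dual
face path from the face row `lo + H` down to the bottom face row inside `R*`. [cite: Nolin2008, §5.2, proof of Thm. 24 (ii)] -/
def fiveArmEnv (M lo H h' H' : ℕ) : Set (BondConfig (Site 2)) :=
  lrCrossingAt ![0, (h' : ℤ)] M H' ∩
    (dualConfig ⁻¹' lrCrossingAt ![0, (lo : ℤ)] (M - 1) H ∩ dualFaceCrossing ![0, 0] M (lo + H))

/-- Almost every configuration is a lattice configuration, so inclusions may assume it. [folklore] -/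
theorem real_le_real_of_subset_lattice (p : unitInterval) {A B : Set (BondConfig (Site 2))}
    (h : ∀ ω, ω ⊆ (zdGraph 2).edgeSet → ω ∈ A → ω ∈ B) :
    (bondPercolation (zdGraph 2) p).real A ≤ (bondPercolation (zdGraph 2) p).real B := by
  refine ENNReal.toReal_mono (measure_ne_top _ _) (measure_mono_ae ?_)
  filter_upwards [ae_subset_edgeSet (zdGraph 2) p] with ω hω hmem
  exact h ω hω hmem

/-- **The environment forces the heights**: on a lattice configuration of `fiveArmEnv`, the faces
of `S*` have rows `< h' + H'` and the above faces have rows `≥ lo` (`lo + H ≤ N`,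
`h' + H' ≤ N`). [cite: Nolin2008, §5.2, proof of Thm. 24 (ii)] -/
theorem heights_of_mem_fiveArmEnv (hω : ω ⊆ (zdGraph 2).edgeSet) (hM : 1 ≤ M) {lo H h' H' : ℕ}
    (hloH : lo + H ≤ N) (h : ω ∈ fiveArmEnv M lo H h' H') :
    (∀ g ∈ dualBelowR M N ω, g 1 < h' + H') ∧ ∀ f, IsAboveFace M N ω f → (lo : ℤ) ≤ f 1 := by
  obtain ⟨hup, hband, hdrop⟩ := h
  constructor
  · obtain ⟨x, y, T, hx, hy, hTs, hTe⟩ := exists_walk_of_mem_lrCrossingAt hω hup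
    simp only [Matrix.cons_val_zero, Matrix.cons_val_one, zero_add] at hx hy hTs
    have := row_lt_of_mem_dualBelowR_of_openLR (M := M) (N := N) hω (h₁ := h' + H') T hx hy
      (fun z hz => by have := hTs z hz; push_cast; omega) hTe
    exact_mod_cast this
  · have hω' : dualConfig ω ⊆ (zdGraph 2).edgeSet := fun _ h => h.1
    obtain ⟨l, r, ζ, hl, hr, hζs, hζe⟩ := exists_walk_of_mem_lrCrossingAt hω' hband
    simp only [Matrix.cons_val_zero, Matrix.cons_val_one, zero_add] at hl hr hζs
    obtain ⟨t, s, η, ht, hs, hηs, hηc⟩ := hdrop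
    simp only [Matrix.cons_val_one, Matrix.cons_val_zero, zero_add, zero_sub] at ht hs hηs
    have hζc : ∀ d ∈ ζ.darts, sepEdge d.fst d.snd ∉ ω := fun d hd =>
      (mem_dualConfig_mk_iff hω d.adj).1 (hζe _ (List.mem_map_of_mem hd))
    have hM1 : ((M - 1 : ℕ) : ℤ) = M - 1 := by omega
    have hζ' : ∀ z ∈ ζ.support, 0 ≤ z 0 ∧ z 0 ≤ (M : ℤ) - 1 ∧ (lo : ℤ) ≤ z 1 ∧ z 1 ≤ lo + H := by
      intro z hz; have := hζs z hz; omega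
    have hr' : r 0 = (M : ℤ) - 1 := by rw [hr]; exact hM1
    have hη' : ∀ z ∈ η.support, 0 ≤ z 0 ∧ z 0 ≤ (M : ℤ) - 1 ∧ -1 ≤ z 1 ∧ z 1 ≤ lo + H := by
      intro z hz; have := hηs z hz; omega
    have hζS := forall_mem_dualBelowR_of_dualLR_of_dualTB (M := M) (N := N) hω hloH ζ hl hr' hζ' hζc η
      (by exact_mod_cast ht) hs hη' hηc
    intro f hf
    exact le_row_of_isAboveFace_of_dualLR hloH ζ hl hr' hζ' hζS hf

open Classical in
/-- **Nolin's conditioning on the lowest crossing, bond-`ℤ²` form.**  For columns `[a₁, a₁ + w₁]`,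
`[a₂, a₂ + w₂)` with `0 ≤ a₁`, `a₁ + w₁ < a₂`, `a₂ + w₂ ≤ M`, and heights `lo + H ≤ N`,
`h' + H' + 2 ≤ N`:
`P(TB(column 1)) · P(TB*(column 2)) · P(fiveArmEnv) ≤ P(fiveArmGood M N lo (h'+H') a₁ (a₁+w₁) a₂ (a₂+w₂+1))`
— sum over the values `D₀` of `S*` realised by the environment: `{S* = D₀}` is determined by
`belowEdges D₀`, the two column events given `D₀` by disjoint sets of edges off `belowEdges D₀`
(independence, `bondPercolation_real_inter_of_disjoint`), and each contains the full crossing of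
its column ("the sites above `c` have not been examined yet, thus remain unbiased; RSW arguments
then imply ..."). [cite: Nolin2008, §5.2, proof of Thm. 24 (ii) (arXiv 0711.4948: Thm. 23 (ii), p. 17)] [cite: KestenScalingCMP1987, proof of Lemma 2] -/
theorem le_real_fiveArmGood (hM : 1 ≤ M) {lo H h' H' : ℕ} (hloH : lo + H ≤ N) (hh' : h' + H' + 2 ≤ N)
    {a₁ a₂ : ℤ} {w₁ w₂ : ℕ} (ha₁ : 0 ≤ a₁) (h12 : a₁ + w₁ < a₂) (ha₂ : a₂ + w₂ ≤ M) :
    (bondPercolation (zdGraph 2) half).real (tbCrossingAt' ![a₁, 0] w₁ N) *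
        (bondPercolation (zdGraph 2) half).real (dualFaceCrossing ![a₂, 0] w₂ N) *
        (bondPercolation (zdGraph 2) half).real (fiveArmEnv M lo H h' H') ≤
      (bondPercolation (zdGraph 2) half).real (fiveArmGood M N lo (h' + H') a₁ (a₁ + w₁) a₂ (a₂ + w₂)) := by
  set μ := bondPercolation (zdGraph 2) half with hμ
  set cA := μ.real (tbCrossingAt' ![a₁, 0] w₁ N) with hcA
  set cD := μ.real (dualFaceCrossing ![a₂, 0] w₂ N) with hcD
  -- the heights predicate and the class of realised data
  set Hts : BondConfig (Site 2) → Prop := fun ω₀ =>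
    (∀ g ∈ dualBelowR M N ω₀, g 1 < h' + H') ∧ ∀ f, IsAboveFace M N ω₀ f → (lo : ℤ) ≤ f 1 with hHts
  set 𝒪 : Finset (Finset (Site 2)) := (dualRectangle M N).powerset.filter fun D₀ =>
    ∃ ω₀ : BondConfig (Site 2), dualBelowR M N ω₀ = D₀ ∧ Hts ω₀ with h𝒪
  set S : Finset (Site 2) → Set (BondConfig (Site 2)) := fun D₀ => {ω | dualBelowR M N ω = D₀} with hS
  set A : Finset (Site 2) → Set (BondConfig (Site 2)) := fun D₀ => attachCol M N D₀ a₁ (a₁ + w₁) with hA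
  set D : Finset (Site 2) → Set (BondConfig (Site 2)) := fun D₀ => dfootCol M N D₀ a₂ (a₂ + w₂) with hD
  -- (1) the environment is covered by the pieces `S D₀`, `D₀ ∈ 𝒪`
  have h1 : μ.real (fiveArmEnv M lo H h' H') ≤ μ.real (⋃ D₀ ∈ 𝒪, S D₀) := by
    refine real_le_real_of_subset_lattice half fun ω hω hmem => ?_
    have hH := heights_of_mem_fiveArmEnv hω hM hloH hmem
    refine Set.mem_biUnion (x := dualBelowR M N ω) ?_ rfl
    rw [Finset.mem_coe, h𝒪, Finset.mem_filter, Finset.mem_powerset]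
    exact ⟨dualBelowR_subset, ω, rfl, hH⟩
  -- (2) the pieces are disjoint and measurable
  have hSdisj : ∀ (T : Finset (Site 2) → Set (BondConfig (Site 2))), (∀ D₀, T D₀ ⊆ S D₀) →
      (↑𝒪 : Set (Finset (Site 2))).PairwiseDisjoint T := by
    intro T hT D₀ _ D₀' _ hne
    exact Set.disjoint_left.2 fun ω h h' => hne ((hT D₀ h).symm.trans (hT D₀' h'))
  have hSm : ∀ D₀, MeasurableSet (S D₀) := fun D₀ => measurableSet_dualBelowR_eq M N D₀
  have h2 : μ.real (⋃ D₀ ∈ 𝒪, S D₀) = ∑ D₀ ∈ 𝒪, μ.real (S D₀) :=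
    measureReal_biUnion_finset (hSdisj S fun _ => subset_rfl) fun D₀ _ => hSm D₀
  -- (3) each piece: independence and the full crossings
  have h3 : ∀ D₀ ∈ 𝒪, cA * cD * μ.real (S D₀) ≤ μ.real (S D₀ ∩ (A D₀ ∩ D D₀)) := by
    intro D₀ hD₀
    obtain ⟨-, ω₀, hω₀, hHts₀⟩ := Finset.mem_filter.1 hD₀
    -- bottom face row inside, top face row outside `D₀`
    have hbot : ∀ x : ℤ, 0 ≤ x → x + 1 ≤ M → (![x, -1] : Site 2) ∈ D₀ := by
      intro x hx hxM
      rw [← hω₀]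
      refine mem_dualBelowR_of_mem_dualBottomSide (Finset.mem_filter.2 ⟨mem_dualRectangle_iff.2 ⟨?_, ?_, ?_, ?_⟩, ?_⟩) <;>
        simp <;> omega
    have htop : ∀ t ∈ dualTopSide M N, t ∉ D₀ := by
      intro t ht htD
      rw [← hω₀] at htD
      have := hHts₀.1 t htD
      have ht1 : t 1 = N := (Finset.mem_filter.1 ht).2
      omega
    have hAD : DeterminedBy (A D₀ ∩ D D₀) ↑(attachColEdges M N D₀ a₁ (a₁ + w₁) ∪ dfootColEdges M N D₀ a₂ (a₂ + w₂)) := by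
      rw [Finset.coe_union]
      exact ((determinedBy_attachCol M N D₀ _ _).mono Set.subset_union_left).inter
        ((determinedBy_dfootCol M N D₀ _ _).mono Set.subset_union_right)
    have hdisj₁ : Disjoint (↑(belowEdges D₀) : Set (Sym2 (Site 2)))
        ↑(attachColEdges M N D₀ a₁ (a₁ + w₁) ∪ dfootColEdges M N D₀ a₂ (a₂ + w₂)) := by
      rw [Finset.disjoint_coe, Finset.disjoint_union_right]
      exact ⟨disjoint_belowEdges_attachColEdges M N D₀ _ _, disjoint_belowEdges_dfootColEdges M N D₀ _ _⟩
    have hdisj₂ : Disjoint (↑(attachColEdges M N D₀ a₁ (a₁ + w₁)) : Set (Sym2 (Site 2))) ↑(dfootColEdges M N D₀ a₂ (a₂ + w₂)) :=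
      Finset.disjoint_coe.2 (disjoint_attachColEdges_dfootColEdges M N D₀ h12)
    have hAm := measurableSet_attachCol M N D₀ a₁ (a₁ + w₁)
    have hDm := measurableSet_dfootCol M N D₀ a₂ (a₂ + w₂)
    rw [hμ, bondPercolation_real_inter_of_disjoint (zdGraph 2) half hdisj₁ (determinedBy_dualBelowR_eq M N D₀) hAD
      (hSm D₀) (hAm.inter hDm), bondPercolation_real_inter_of_disjoint (zdGraph 2) half hdisj₂
      (determinedBy_attachCol M N D₀ _ _) (determinedBy_dfootCol M N D₀ _ _) hAm hDm]
    have hA' : cA ≤ (bondPercolation (zdGraph 2) half).real (A D₀) :=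
      real_le_real_of_subset_lattice half fun ω hω hmem =>
        mem_attachCol_of_tbCrossingAt' hω hM hbot ha₁ (by omega) hmem
    have hD' : cD ≤ (bondPercolation (zdGraph 2) half).real (D D₀) :=
      measureReal_mono (dualFaceCrossing_subset_dfootCol hbot htop (by omega) ha₂) (measure_ne_top _ _)
    calc cA * cD * (bondPercolation (zdGraph 2) half).real (S D₀)
        = (bondPercolation (zdGraph 2) half).real (S D₀) * (cA * cD) := by ring
      _ ≤ (bondPercolation (zdGraph 2) half).real (S D₀) *
            ((bondPercolation (zdGraph 2) half).real (A D₀) * (bondPercolation (zdGraph 2) half).real (D D₀)) :=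
          mul_le_mul_of_nonneg_left (mul_le_mul hA' hD' measureReal_nonneg measureReal_nonneg) measureReal_nonneg
  -- (4) the pieces lie in the good event
  have h4 : ∀ D₀ ∈ 𝒪, S D₀ ∩ (A D₀ ∩ D D₀) ⊆ fiveArmGood M N lo (h' + H') a₁ (a₁ + w₁) a₂ (a₂ + w₂) := by
    intro D₀ hD₀ ω hω
    obtain ⟨-, ω₀, hω₀, hHts₀⟩ := Finset.mem_filter.1 hD₀
    obtain ⟨hSω, hAω, hDω⟩ := hω
    have hSω' : dualBelowR M N ω = D₀ := hSω
    have heq : dualBelowR M N ω = dualBelowR M N ω₀ := hSω'.trans hω₀.symm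
    have hrows : ∀ g ∈ dualBelowR M N ω, g 1 < h' + H' := fun g hg => hHts₀.1 g (heq ▸ hg)
    refine ⟨fun t ht htB => ?_, hrows, fun f hf => hHts₀.2 f ((isAboveFace_congr heq f).1 hf), ?_, ?_⟩
    · have := hrows t htB
      have ht1 : t 1 = N := (Finset.mem_filter.1 ht).2
      omega
    · rw [hSω']; exact hAω
    · rw [hSω']; exact hDω
  -- assemble
  have hmeas : ∀ D₀ ∈ 𝒪, MeasurableSet (S D₀ ∩ (A D₀ ∩ D D₀)) := fun D₀ _ =>
    (hSm D₀).inter ((measurableSet_attachCol M N D₀ _ _).inter (measurableSet_dfootCol M N D₀ _ _))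
  calc cA * cD * μ.real (fiveArmEnv M lo H h' H')
      ≤ cA * cD * μ.real (⋃ D₀ ∈ 𝒪, S D₀) :=
        mul_le_mul_of_nonneg_left h1 (mul_nonneg measureReal_nonneg measureReal_nonneg)
    _ = ∑ D₀ ∈ 𝒪, cA * cD * μ.real (S D₀) := by rw [h2, Finset.mul_sum]
    _ ≤ ∑ D₀ ∈ 𝒪, μ.real (S D₀ ∩ (A D₀ ∩ D D₀)) := Finset.sum_le_sum h3
    _ = μ.real (⋃ D₀ ∈ 𝒪, S D₀ ∩ (A D₀ ∩ D D₀)) :=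
        (measureReal_biUnion_finset (hSdisj _ fun _ => Set.inter_subset_left) hmeas).symm
    _ ≤ μ.real (fiveArmGood M N lo (h' + H') a₁ (a₁ + w₁) a₂ (a₂ + w₂)) :=
        measureReal_mono (Set.iUnion₂_subset h4) (measure_ne_top _ _)

/-! ### The probability of the environment -/

/-- A point of `dualEdge e` is at most one row below some point of `e`. [folklore] -/
theorem exists_mem_row_le_of_mem_dualEdge {e : Sym2 (Site 2)} {z : Site 2} (hz : z ∈ dualEdge e) :
    ∃ x ∈ e, x 1 - 1 ≤ z 1 := by
  by_cases he : e ∈ (zdGraph 2).edgeSet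
  · obtain ⟨u, i, rfl⟩ := mem_edgeSet_zdGraph_iff.1 he
    have hi : i ≠ i + 1 := by fin_cases i <;> decide
    rw [dualEdge_single_eq hi] at hz
    refine ⟨u, Sym2.mem_mk_left _ _, ?_⟩
    rcases Sym2.mem_iff.1 hz with rfl | rfl
    · simp only [Pi.sub_apply, Pi.single_apply]
      split_ifs <;> omega
    · omega
  · rw [dualEdge_of_not_mem he] at hz
    exact ⟨z, hz, by omega⟩

/-- The open band crossing is determined by the pairs of sites of the band. [folklore] -/
theorem determinedBy_lrCrossingAt (u : Site 2) (M n : ℕ) :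
    DeterminedBy (lrCrossingAt u M n) ↑((rectangle M n).image (· + u)).sym2 := by
  have : ((· + u) '' (rectangle M n : Set (Site 2))) = ↑((rectangle M n).image (· + u)) := Finset.coe_image.symm
  rw [lrCrossingAt, this]
  exact PlanarDuality.determinedBy_openCrossing _ _ _

/-- The environment event is measurable. [folklore] -/
theorem measurableSet_fiveArmEnv (M lo H h' H' : ℕ) : MeasurableSet (fiveArmEnv M lo H h' H') :=
  (measurableSet_lrCrossingAt _ _ _).inter
    ((measurable_dualConfig (measurableSet_lrCrossingAt _ _ _)).inter (measurableSet_dualFaceCrossing _ _ _))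

/-- **RSW lower bound for the environment.**  With the RSW constant `c` of aspect ratio `k`
(`c ≤ h(kl, l)` for all `l ≥ 1`, `rsw_lowerBound_holds k`): if `M ≤ k(H'+1) - 1`,
`M - 1 ≤ k(H+1) - 1`, `lo + H + 1 ≤ kM - 1` and the two regions are separated (`lo + H + 3 ≤ h'`),
then `c³ ≤ P(fiveArmEnv M lo H h' H')`: the open band crossing is independent of the two
closed-dual events (disjoint sets of edges), which are positively correlated (Harris, both
decreasing), and each of the three has probability `≥ c` (for the dual band crossing through
`P_{1/2}(dualConfig ⁻¹' E) = P_{1/2}(E)`). [cite: Nolin2008, §5.2, proof of Thm. 24 (ii) ("By standard RSW-type arguments")] -/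
theorem le_real_fiveArmEnv {k : ℕ} {c : ℝ} (hc0 : 0 ≤ c)
    (hc : ∀ l : ℕ, 1 ≤ l → c ≤ crossingProb half (k * l - 1) (l - 1)) (hM : 1 ≤ M) {lo H h' H' : ℕ}
    (hup : M ≤ k * (H' + 1) - 1) (hband : M - 1 ≤ k * (H + 1) - 1) (hdrop : lo + H + 1 ≤ k * M - 1)
    (hsep : lo + H + 3 ≤ h') :
    c * c * c ≤ (bondPercolation (zdGraph 2) half).real (fiveArmEnv M lo H h' H') := by
  set μ := bondPercolation (zdGraph 2) half with hμ
  set Eup := lrCrossingAt ![0, (h' : ℤ)] M H' with hEup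
  set Eband : Set (BondConfig (Site 2)) := dualConfig ⁻¹' lrCrossingAt ![0, (lo : ℤ)] (M - 1) H with hEband
  set Edrop := dualFaceCrossing ![0, 0] M (lo + H) with hEdrop
  -- the three RSW bounds
  have h1 : c ≤ μ.real Eup := by
    rw [hEup, hμ, bondPercolation_real_lrCrossingAt]
    have h := hc (H' + 1) (by omega)
    rw [Nat.add_sub_cancel] at h
    exact h.trans (crossingProb_anti_left half hup H')
  have h2 : c ≤ μ.real Eband := by
    rw [hEband, hμ, ← map_measureReal_apply measurable_dualConfig (measurableSet_lrCrossingAt _ _ _),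
      bondPercolation_map_dualConfig_holds half, symm_half, bondPercolation_real_lrCrossingAt]
    have h := hc (H + 1) (by omega)
    rw [Nat.add_sub_cancel] at h
    exact h.trans (crossingProb_anti_left half hband H)
  have h3 : c ≤ μ.real Edrop := by
    have := crossingProb_le_real_dualFaceCrossing (![0, 0] : Site 2) (M - 1) (lo + H)
    rw [Nat.sub_add_cancel hM] at this
    refine le_trans ?_ this
    have h := hc M hM
    exact h.trans (crossingProb_anti_left half hdrop _)
  -- Harris for the two decreasing dual events
  have hband_low : IsLowerSet Eband := fun ω ω' hle h =>
    isUpperSet_lrCrossingAt _ _ _ (dualConfig_antitone hle) h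
  have h23 : c * c ≤ μ.real (Eband ∩ Edrop) :=
    le_real_inter_of_lower hc0 hc0 hband_low (isLowerSet_dualFaceCrossing _ _ _)
      (measurable_dualConfig (measurableSet_lrCrossingAt _ _ _)) (measurableSet_dualFaceCrossing _ _ _) h2 h3
  -- independence of the band above from the dual events below
  set Fup : Finset (Sym2 (Site 2)) := ((rectangle M H').image (· + (![0, (h' : ℤ)] : Site 2))).sym2 with hFup
  set Fdual : Set (Sym2 (Site 2)) :=
    dualEdge ⁻¹' ↑((rectangle (M - 1) H).image (· + (![0, (lo : ℤ)] : Site 2))).sym2 ∪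
      ↑(dualFaceCrossingPairs ![0, 0] M (lo + H)) with hFdual
  have hdetU : DeterminedBy Eup ↑Fup := determinedBy_lrCrossingAt _ _ _
  have hdetD : DeterminedBy (Eband ∩ Edrop) Fdual :=
    ((determinedBy_lrCrossingAt _ _ _).preimage_dualConfig.mono Set.subset_union_left).inter
      ((determinedBy_dualFaceCrossing _ _ _).mono Set.subset_union_right)
  have hrowU : ∀ e ∈ (↑Fup : Set (Sym2 (Site 2))), ∀ x ∈ e, (h' : ℤ) ≤ x 1 := by
    intro e he x hx
    have := (Finset.mem_sym2_iff.1 (Finset.mem_coe.1 he)) x hx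
    obtain ⟨y, hy, rfl⟩ := Finset.mem_image.1 this
    have := (mem_rectangle_iff.1 hy).2.2.1
    simp only [Pi.add_apply, Matrix.cons_val_one, Matrix.cons_val_zero]
    omega
  have hdisj : Disjoint (↑Fup : Set (Sym2 (Site 2))) Fdual := by
    rw [Set.disjoint_left]
    intro e he he'
    rcases he' with he' | he'
    · -- a point of `dualEdge e` is in the face band, rows `≤ lo + H`, but `≥ h' - 1`
      rw [Set.mem_preimage, Finset.mem_coe, Finset.mem_sym2_iff] at he'
      obtain ⟨z, hz⟩ : ∃ z, z ∈ dualEdge e := ⟨_, Sym2.out_fst_mem _⟩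
      obtain ⟨x, hx, hxz⟩ := exists_mem_row_le_of_mem_dualEdge hz
      have h1 := hrowU e he x hx
      obtain ⟨y, hy, rfl⟩ := Finset.mem_image.1 (he' z hz)
      have := (mem_rectangle_iff.1 hy).2.2.2
      simp only [Pi.add_apply, Matrix.cons_val_one, Matrix.cons_val_zero] at hxz
      omega
    · rw [Finset.mem_coe, dualFaceCrossingPairs, Finset.mem_sym2_iff] at he'
      obtain ⟨x, hx⟩ : ∃ x, x ∈ e := ⟨_, Sym2.out_fst_mem _⟩
      have h1 := hrowU e he x hx
      have h2 := (mem_Icc_dualFace_iff.1 (he' x hx)).2.2.2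
      simp only [Matrix.cons_val_one, Matrix.cons_val_zero] at h2
      omega
  have hind : μ.real (Eup ∩ (Eband ∩ Edrop)) = μ.real Eup * μ.real (Eband ∩ Edrop) :=
    bondPercolation_real_inter_of_disjoint (zdGraph 2) half hdisj hdetU hdetD (measurableSet_lrCrossingAt _ _ _)
      ((measurable_dualConfig (measurableSet_lrCrossingAt _ _ _)).inter (measurableSet_dualFaceCrossing _ _ _))
  calc c * c * c = c * (c * c) := by ring
    _ ≤ μ.real Eup * μ.real (Eband ∩ Edrop) := mul_le_mul h1 h23 (mul_nonneg hc0 hc0) (hc0.trans h1)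
    _ = μ.real (fiveArmEnv M lo H h' H') := by rw [← hind]; rfl

end Literature.Probability.Percolation

end
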